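import Literature.NumberTheory.Rogawski1990.FinExplicitTransferFactorConjLeft      -- ★ N1f-l: the `H_v`-conjugacy twin (`finExplicitDelta_conj_left`) and ★ `FinExplicitTransferFactor`
import HarnessLib

/-!
# Rogawski's explicit finite transfer factor `Δ‴_v(γ_H, γ′)` depends only on the STABLE conjugacy class of `γ_H` in `H_v` (Rogawski (1990) §4.3 p. 43)

Topic `NumberTheory/Rogawski1990`; namespace `Literature.NumberTheory.Rogawski1990`.  THEOREMS ONLY (no definition, no named fact, no instance, no notation,
no `sorry`; net debt 0).  Cell `pub/hodgecm-mathlib`, F0∕P3a, topic T8 (row N6-ns-reg (iv-d) «Δ‴ STABLE-LEFT-INVARIANCE», LEAD F0P3a-plan (g9) T8-17 (B)(3); consumer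
F0P3a-p08 (g12)'s census `F0/P3a/F0P3a-p08/g12/CENSUS-N6ns-reg-iv-Hside.F0P3a-p08g12.md` §1 (iv-d); census `B-provers/B-p10/g23/CENSUS-ivd-DeltaStableInvariance.B-p10g23.md`).
By import over ★ `FinExplicitTransferFactorConjLeft` (the `H_v`-CONJUGACY invariance, whose section structure is reused with the conjugator moved to the ambient
`GL₂(E_v) × GL₁(E_v)`).  Mathlib-only footing; count-neutral for the books.

THE PRINT [Rogawski1990 §4.3 p. 43]: «… `Δ_{G∕H}(γ_H, γ)` … depends only on the stable conjugacy class of `γ_H` in `H` …»; [LanglandsShelstad1987 §1]: transfer factors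
are functions of (stable) classes.  In the tree, stable conjugacy in `H_v = U(Φ₂)(L⁺_v) × U(Φ₁)(L⁺_v)` is ★ `IsLocalStablyConjH L v γ_H γ_H′` = componentwise ★ `IsStablyConj`
= conjugacy in the AMBIENT `GL₂(E_v)`, `GL₁(E_v)` (`E_v = Π_{w∣v} L_w`); and every ingredient of ★ `finExplicitDelta L v H′ γ_H μ γ′ = τ_v · D_v · κ_v` (on the matching
pairs, `0` off them) reads `γ_H = (g, u)` only through `u` (`GL₁` is abelian), `tr g`, `det g` (the characteristic polynomial of `g`, a `GL₂(E_v)`-class function):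
`τ_v` (★ `finTau`: `μ_v(u)·μ_v(−χ_g(u)∕det g)⁻¹`), `D_v` (★ `finWeylRatio`: `‖χ_g(u)‖^{1∕2}`), `κ_v` (★ `finKappaAt`, through `P_v = χ_g(γ′) = γ′² − tr g·γ′ + det g` ★
`finEigenlineProjector` and the `H′_v`-values of its columns), and the support ★ `IsLocalNormPair` (`= IsConj (endoGL (g, u)) γ′` in `GL₃(E_v)`, transported along the
group homomorphism ★ `endoGL`).  Hence **`Δ‴_v(γ_H′, γ′) = Δ‴_v(γ_H, γ′)` whenever `γ_H ∼_st γ_H′`, at EVERY finite place `v` (split or not), with no frame hypothesis.**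

* §1 class functions under `IsLocalStablyConjH`: `finGammaTwo_eq_of_isLocalStablyConjH`, `finCharpolyTwo_eq_…`, `det_inv_fst_eq_…`, `finTauArg_eq_…`, `finTau_eq_…`,
  `finWeylRatio_eq_…`, `finEigenlineProjector_eq_…`, `finColumnFormValue_eq_…`, `finRelPos_eq_…`, `finKappaAt_eq_of_isLocalStablyConjH`,
  `isStablyConj_endoEmbLocal_of_isLocalStablyConjH` (`ι_v` preserves stable conjugacy), `isLocalNormPair_iff_of_isLocalStablyConjH`.
* §2 **`finExplicitDelta_eq_of_isLocalStablyConjH`** (HEAD), `finExplicitDelta_eq_of_isLocalStablyConjH_all`, and the collection form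
  **`finExplicitCollection_Δ_eq_of_isLocalStablyConjH`** (`T := (finExplicitCollection L H′ μ hl hr) v`, the (HLOC)∕(iv) consumer's currency).
NOT here: local constancy of `Δ‴_v` in `γ_H` on the regular set (★ `continuousOn_finExplicitDelta` is the continuity half), H-side surjectivity (iv-a…c).
HONEST LABEL: HC_CM is proved only modulo the printed citations (named inputs remaining 2) until rung 0 closes; this file proves none of them.

## References
* [Rogawski1990] J. D. Rogawski, *Automorphic Representations of Unitary Groups in Three Variables*, Ann. of Math. Stud. 123 (1990), §3.1 p. 19 (stable conjugacy =
  `GL_n`-conjugacy for unitary groups), §4.3 p. 43 (`Δ_{G∕H}` on stable classes of `γ_H`), §4.9 p. 55 (`τ`, `D_{G∕H}`), §14.1 p. 232, §14.6 p. 242 (`κ`).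
* [LanglandsShelstad1987] R. P. Langlands, D. Shelstad, *On the definition of transfer factors*, Math. Ann. 278 (1987), §1.
-/

set_option autoImplicit false

noncomputable section

open NumberField IsDedekindDomain Matrix Polynomial
open Literature.NumberTheory.GaloisRepresentations
open scoped MatrixGroups

namespace Literature.NumberTheory.Rogawski1990

open Literature.NumberTheory.Automorphic

variable (L : Type) [Field L] [NumberField L] [IsCMField L] (v : HeightOneSpectrum (𝓞 ↥(maximalRealSubfield L)))

/-! ## §1 The ingredients of `Δ‴_v` are stable class functions of `γ_H` -/

section ClassFunctions

variable (H' : Matrix (Fin 3) (Fin 3) L)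
  {a a' : (UnitaryGroup.cmDatum L 2 (Matrix.of fun i j : Fin 2 => if i.val + j.val + 1 = 2 then (1 : L) else 0)).Local v ×
      (UnitaryGroup.cmDatum L 1 (Matrix.of fun i j : Fin 1 => if i.val + j.val + 1 = 1 then (1 : L) else 0)).Local v}
  (h : IsLocalStablyConjH L v a a')

include h in
/-- `γ₂ = u` is a STABLE class function on `H_v` (the `U(Φ₁)`-coordinate is conjugated inside the abelian `GL₁(E_v)`: `u = det`). [cite: Rogawski1990, §4.9 p. 55; §3.1 p. 19] -/
theorem finGammaTwo_eq_of_isLocalStablyConjH : finGammaTwo L v a' = finGammaTwo L v a := by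
  obtain ⟨c, hc⟩ := isConj_iff.1 h.2
  unfold finGammaTwo
  rw [← hc, Units.val_mul, Units.val_mul]
  have e1 := Matrix.det_fin_one ((c : GL (Fin 1) (UnitaryGroup.LocalRing L v)).val * (a.2.val : GL (Fin 1) (UnitaryGroup.LocalRing L v)).val *
    (c⁻¹ : GL (Fin 1) (UnitaryGroup.LocalRing L v)).val)
  have e2 := Matrix.det_fin_one ((a.2.val : GL (Fin 1) (UnitaryGroup.LocalRing L v)).val)
  rw [← e1, ← e2, Matrix.det_units_conj]

include h in
/-- `χ_g` is a STABLE class function on `H_v` (`charpoly (c g c⁻¹) = charpoly g` in `GL₂(E_v)`). [cite: Rogawski1990, §4.9 p. 55; §3.1 p. 19] -/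
theorem finCharpolyTwo_eq_of_isLocalStablyConjH : finCharpolyTwo L v a' = finCharpolyTwo L v a := by
  obtain ⟨c, hc⟩ := isConj_iff.1 h.1
  unfold finCharpolyTwo
  rw [← hc, Units.val_mul, Units.val_mul, Matrix.coe_units_inv, Matrix.charpoly_units_conj]

include h in
/-- `det g⁻¹` is a STABLE class function on `H_v`. [cite: Rogawski1990, §4.9 p. 55; §3.1 p. 19] -/
theorem det_inv_fst_eq_of_isLocalStablyConjH :
    (((a'.1.val : GL (Fin 2) (UnitaryGroup.LocalRing L v))⁻¹ : GL (Fin 2) (UnitaryGroup.LocalRing L v)) : Matrix (Fin 2) (Fin 2) (UnitaryGroup.LocalRing L v)).det =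
      (((a.1.val⁻¹ : GL (Fin 2) (UnitaryGroup.LocalRing L v)) : Matrix (Fin 2) (Fin 2) (UnitaryGroup.LocalRing L v))).det := by
  obtain ⟨c, hc⟩ := isConj_iff.1 h.1
  have hinv : ((a'.1.val : GL (Fin 2) (UnitaryGroup.LocalRing L v))⁻¹ : GL (Fin 2) (UnitaryGroup.LocalRing L v)) =
      c * ((a.1.val : GL (Fin 2) (UnitaryGroup.LocalRing L v))⁻¹) * c⁻¹ := by
    rw [← hc, _root_.mul_inv_rev, _root_.mul_inv_rev, inv_inv, mul_assoc]
  rw [hinv, Units.val_mul, Units.val_mul, Matrix.det_units_conj]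

include h in
/-- `τ_v`'s argument `t = −χ_g(u)·det g⁻¹` is a STABLE class function on `H_v`. [cite: Rogawski1990, §4.9 p. 55] -/
theorem finTauArg_eq_of_isLocalStablyConjH : finTauArg L v a' = finTauArg L v a := by
  unfold finTauArg
  rw [finCharpolyTwo_eq_of_isLocalStablyConjH L v h, finGammaTwo_eq_of_isLocalStablyConjH L v h, det_inv_fst_eq_of_isLocalStablyConjH L v h]

include h in
/-- **`τ_v(γ_H)` is a STABLE class function on `H_v`.** [cite: Rogawski1990, §4.9 p. 55; §4.3 p. 43] -/
theorem finTau_eq_of_isLocalStablyConjH (μ : HeckeCharacter L) : finTau L v a' μ = finTau L v a μ := by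
  unfold finTau
  rw [finGammaTwo_eq_of_isLocalStablyConjH L v h, finTauArg_eq_of_isLocalStablyConjH L v h]

include h in
/-- **`D_{G∕H,v}(γ_H)` is a STABLE class function on `H_v`.** [cite: Rogawski1990, §4.9 p. 55; §4.3 p. 43] -/
theorem finWeylRatio_eq_of_isLocalStablyConjH : finWeylRatio L v a' = finWeylRatio L v a := by
  unfold finWeylRatio
  rw [finCharpolyTwo_eq_of_isLocalStablyConjH L v h, finGammaTwo_eq_of_isLocalStablyConjH L v h]

include h in
/-- `P_v = χ_g(γ′) = γ′² − tr g·γ′ + det g` depends on `γ_H` only through `tr g`, `det g` — STABLE class functions. [cite: Rogawski1990, §4.9 p. 55; §14.6 p. 242] -/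
theorem finEigenlineProjector_eq_of_isLocalStablyConjH (γ' : (UnitaryGroup.cmDatum L 3 H').Local v) :
    finEigenlineProjector L v H' a' γ' = finEigenlineProjector L v H' a γ' := by
  have hc := finCharpolyTwo_eq_of_isLocalStablyConjH L v h
  unfold finCharpolyTwo at hc
  have htr := congrArg (fun p : Polynomial (UnitaryGroup.LocalRing L v) => -p.coeff (Fintype.card (Fin 2) - 1)) hc
  have hdet := congrArg (fun p : Polynomial (UnitaryGroup.LocalRing L v) => (-1 : UnitaryGroup.LocalRing L v) ^ Fintype.card (Fin 2) * p.coeff 0) hc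
  simp only [← Matrix.trace_eq_neg_charpoly_coeff, ← Matrix.det_eq_sign_charpoly_coeff] at htr hdet
  unfold finEigenlineProjector
  simp only [htr, hdet]

include h in
/-- The column form values `x_j = p_jᴴ H′_v p_j` are STABLE class functions of `γ_H`. [cite: Rogawski1990, §3.5 Prop. 3.5.2 (c) p. 29; §4.3 p. 43] -/
theorem finColumnFormValue_eq_of_isLocalStablyConjH (γ' : (UnitaryGroup.cmDatum L 3 H').Local v) (j : Fin 3) :
    finColumnFormValue L v H' a' γ' j = finColumnFormValue L v H' a γ' j := by
  unfold finColumnFormValue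
  rw [finEigenlineProjector_eq_of_isLocalStablyConjH L v H' h]

include h in
open scoped Classical in
/-- The relative position `x_v(γ_H, γ′)` is a STABLE class function of `γ_H`. [cite: Rogawski1990, §4.3 p. 43] [cite: LanglandsShelstad1987, §1] -/
theorem finRelPos_eq_of_isLocalStablyConjH (γ' : (UnitaryGroup.cmDatum L 3 H').Local v) :
    finRelPos L v H' a' γ' = finRelPos L v H' a γ' := by
  unfold finRelPos
  simp only [finEigenlineProjector_eq_of_isLocalStablyConjH L v H' h, finColumnFormValue_eq_of_isLocalStablyConjH L v H' h]

include h in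
open scoped Classical in
/-- **`κ_v(γ_H, γ′)` is a STABLE class function of `γ_H`** (it is read through `P_v = χ_g(γ′)`, a polynomial in `tr g`, `det g` — no eigen-line labelling enters).
[cite: Rogawski1990, §14.6 p. 242; §4.3 p. 43] [cite: LanglandsShelstad1987, §1] -/
theorem finKappaAt_eq_of_isLocalStablyConjH (γ' : (UnitaryGroup.cmDatum L 3 H').Local v) :
    finKappaAt L v H' a' γ' = finKappaAt L v H' a γ' := by
  unfold finKappaAt
  rw [finEigenlineProjector_eq_of_isLocalStablyConjH L v H' h, finRelPos_eq_of_isLocalStablyConjH L v H' h]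

include h in
/-- **`ι_v` preserves stable conjugacy**: `γ_H ∼_st γ_H′` in `H_v` ⇒ `ι_v(γ_H) ∼_st ι_v(γ_H′)` in `U(Φ₃)(L⁺_v)` (conjugate by `endoGL (c₁, c₂) ∈ GL₃(E_v)`; ★ `endoGL` is a
homomorphism, ★ `coe_endoEmb`). [cite: Rogawski1990, §4.2 p. 42; §3.1 p. 19] -/
theorem isStablyConj_endoEmbLocal_of_isLocalStablyConjH :
    IsStablyConj (UnitaryGroup.conjLocal L (IsCMField.complexConj L) v)
      ((UnitaryGroup.adelicForm L 3 (Matrix.of fun i j : Fin 3 => if i.val + j.val + 1 = 3 then (1 : L) else 0)).map (UnitaryGroup.adeleToLocal L v))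
      (endoEmbLocal L v a) (endoEmbLocal L v a') := by
  obtain ⟨c₁, hc₁⟩ := isConj_iff.1 h.1
  obtain ⟨c₂, hc₂⟩ := isConj_iff.1 h.2
  have e : ∀ b : (UnitaryGroup.cmDatum L 2 (Matrix.of fun i j : Fin 2 => if i.val + j.val + 1 = 2 then (1 : L) else 0)).Local v ×
      (UnitaryGroup.cmDatum L 1 (Matrix.of fun i j : Fin 1 => if i.val + j.val + 1 = 1 then (1 : L) else 0)).Local v,
      ((endoEmbLocal L v b : (UnitaryGroup.cmDatum L 3 (Matrix.of fun i j : Fin 3 => if i.val + j.val + 1 = 3 then (1 : L) else 0)).Local v).val :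
        GL (Fin 3) (UnitaryGroup.LocalRing L v)) =
        endoGL ((b.1.val : GL (Fin 2) (UnitaryGroup.LocalRing L v)), (b.2.val : GL (Fin 1) (UnitaryGroup.LocalRing L v))) := fun _ => rfl
  refine isConj_iff.2 ⟨endoGL (c₁, c₂), ?_⟩
  rw [e a, e a', ← map_inv, ← map_mul, ← map_mul, Prod.inv_mk, Prod.mk_mul_mk, Prod.mk_mul_mk, hc₁, hc₂]

include h in
/-- **`ι_v(γ_H′) ↔ γ′` iff `ι_v(γ_H) ↔ γ′`** — the matching relation sees only the stable class of `γ_H` (★ `Corresponds.of_isStablyConj_left`).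
[cite: Rogawski1990, §14.1 p. 232; §4.3 p. 43] -/
theorem isLocalNormPair_iff_of_isLocalStablyConjH (γ' : (UnitaryGroup.cmDatum L 3 H').Local v) :
    IsLocalNormPair L H' v a' γ' ↔ IsLocalNormPair L H' v a γ' := by
  have hst := isStablyConj_endoEmbLocal_of_isLocalStablyConjH L v h
  rw [isLocalNormPair_iff, isLocalNormPair_iff]
  exact ⟨fun h' => h'.of_isStablyConj_left hst.symm, fun h' => h'.of_isStablyConj_left hst⟩

end ClassFunctions

/-! ## §2 `Δ‴_v` on stable classes of `γ_H` -/

section Delta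

variable (H' : Matrix (Fin 3) (Fin 3) L)

open scoped Classical in
/-- **`Δ‴_v(γ_H′, γ′) = Δ‴_v(γ_H, γ′)` FOR STABLY CONJUGATE `γ_H ∼_st γ_H′` IN `H_v`**, at every finite place `v` and every `γ′ ∈ U(H′)(L⁺_v)`: on a matching pair
`Δ‴_v = τ_v · D_v · κ_v` with all three factors stable class functions of `γ_H` (§1), and the matching pairs of `γ_H′` are those of `γ_H`; off them both sides vanish.  Print:
«`Δ_{G∕H}(γ_H, γ)` depends only on the stable conjugacy class of `γ_H` in `H`». [cite: Rogawski1990, §4.3 p. 43; §4.9 p. 55] [cite: LanglandsShelstad1987, §1] -/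
theorem finExplicitDelta_eq_of_isLocalStablyConjH (μ : HeckeCharacter L)
    {a a' : (UnitaryGroup.cmDatum L 2 (Matrix.of fun i j : Fin 2 => if i.val + j.val + 1 = 2 then (1 : L) else 0)).Local v ×
      (UnitaryGroup.cmDatum L 1 (Matrix.of fun i j : Fin 1 => if i.val + j.val + 1 = 1 then (1 : L) else 0)).Local v}
    (h : IsLocalStablyConjH L v a a') (b : (UnitaryGroup.cmDatum L 3 H').Local v) :
    finExplicitDelta L v H' a' μ b = finExplicitDelta L v H' a μ b := by
  by_cases hb : IsLocalNormPair L H' v a b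
  · rw [finExplicitDelta_of_isLocalNormPair L v H' _ μ ((isLocalNormPair_iff_of_isLocalStablyConjH L v H' h b).2 hb),
      finExplicitDelta_of_isLocalNormPair L v H' _ μ hb, finTau_eq_of_isLocalStablyConjH L v h, finWeylRatio_eq_of_isLocalStablyConjH L v h,
      finKappaAt_eq_of_isLocalStablyConjH L v H' h]
  · rw [finExplicitDelta_of_not_isLocalNormPair L v H' _ μ (fun h' => hb ((isLocalNormPair_iff_of_isLocalStablyConjH L v H' h b).1 h')),
      finExplicitDelta_of_not_isLocalNormPair L v H' _ μ hb]

open scoped Classical in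
/-- The same, quantified over all finite places and classes (binder form). [cite: Rogawski1990, §4.3 p. 43] -/
theorem finExplicitDelta_eq_of_isLocalStablyConjH_all (μ : HeckeCharacter L) :
    ∀ (v : HeightOneSpectrum (𝓞 ↥(maximalRealSubfield L)))
      (a a' : (UnitaryGroup.cmDatum L 2 (Matrix.of fun i j : Fin 2 => if i.val + j.val + 1 = 2 then (1 : L) else 0)).Local v ×
          (UnitaryGroup.cmDatum L 1 (Matrix.of fun i j : Fin 1 => if i.val + j.val + 1 = 1 then (1 : L) else 0)).Local v)
      (b : (UnitaryGroup.cmDatum L 3 H').Local v),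
      IsLocalStablyConjH L v a a' → finExplicitDelta L v H' a' μ b = finExplicitDelta L v H' a μ b :=
  fun v _ _ b h => finExplicitDelta_eq_of_isLocalStablyConjH L v H' μ h b

open scoped Classical in
/-- **Collection form**: the member at `v` of the explicit finite collection ★ `finExplicitCollection L H′ μ hl hr` (any invariance families `hl`, `hr`) has `Δ` constant on
the stable classes of `γ_H` — the shape consumed by the local-transfer statements at `T := (finExplicitCollection …) v`. [cite: Rogawski1990, §4.3 p. 43; §4.9 p. 55] -/
theorem finExplicitCollection_Δ_eq_of_isLocalStablyConjH (μ : HeckeCharacter L)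
    (hl : ∀ (v : HeightOneSpectrum (𝓞 ↥(maximalRealSubfield L)))
      (a : (UnitaryGroup.cmDatum L 2 (Matrix.of fun i j : Fin 2 => if i.val + j.val + 1 = 2 then (1 : L) else 0)).Local v ×
      (UnitaryGroup.cmDatum L 1 (Matrix.of fun i j : Fin 1 => if i.val + j.val + 1 = 1 then (1 : L) else 0)).Local v)
      (b : (UnitaryGroup.cmDatum L 3 H').Local v)
      (x : (UnitaryGroup.cmDatum L 2 (Matrix.of fun i j : Fin 2 => if i.val + j.val + 1 = 2 then (1 : L) else 0)).Local v ×
      (UnitaryGroup.cmDatum L 1 (Matrix.of fun i j : Fin 1 => if i.val + j.val + 1 = 1 then (1 : L) else 0)).Local v),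
      finExplicitDelta L v H' (x * a * x⁻¹) μ b = finExplicitDelta L v H' a μ b)
    (hr : ∀ (v : HeightOneSpectrum (𝓞 ↥(maximalRealSubfield L)))
      (a : (UnitaryGroup.cmDatum L 2 (Matrix.of fun i j : Fin 2 => if i.val + j.val + 1 = 2 then (1 : L) else 0)).Local v ×
      (UnitaryGroup.cmDatum L 1 (Matrix.of fun i j : Fin 1 => if i.val + j.val + 1 = 1 then (1 : L) else 0)).Local v)
      (b y : (UnitaryGroup.cmDatum L 3 H').Local v),
      finExplicitDelta L v H' a μ (y * b * y⁻¹) = finExplicitDelta L v H' a μ b)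
    {a a' : (UnitaryGroup.cmDatum L 2 (Matrix.of fun i j : Fin 2 => if i.val + j.val + 1 = 2 then (1 : L) else 0)).Local v ×
      (UnitaryGroup.cmDatum L 1 (Matrix.of fun i j : Fin 1 => if i.val + j.val + 1 = 1 then (1 : L) else 0)).Local v}
    (h : IsLocalStablyConjH L v a a') (b : (UnitaryGroup.cmDatum L 3 H').Local v) :
    (finExplicitCollection L H' μ hl hr v).Δ a' b = (finExplicitCollection L H' μ hl hr v).Δ a b := by
  rw [finExplicitCollection_Δ, finExplicitCollection_Δ]
  exact finExplicitDelta_eq_of_isLocalStablyConjH L v H' μ h b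

end Delta

end Literature.NumberTheory.Rogawski1990

end
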